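import Summits.ABC.ABC.Theses.TwoSixPencil
import Literature.NumberTheory.DiophantineGeometry.MinimalDiscriminantProofs
import HarnessLib

/-!
# The ℤ/2×ℤ/6 payoff: pencil engine (k = 6) + dictionary ⇒ Szpiro exponent `1/6` on the class

`Summits/ABC/ABC/Theorems/TwoSixPencilTwoSixPayoff.lean` — closes the support item stmt-ABC-24785
`Summit.ABC.ABC.Theses.TwoSixPencil.TwoSixPayoff` (`PencilBound → TwoSixDictionary →
TwoSixClassEpsShape`) of route `TwoSixPencil` (abc-idea-1 g4, LINE g4-2). Real-analysis glue only:

* `abs_disc_le`: `|64 w⁶(u−w)⁶(u−3w)²(u+3w)²(u−5w)⁶(u−9w)²| ≤ 4892236185600 · H²⁴`,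
  `H = max(|u|, |w|)` (`|u − cw| ≤ (1+|c|) H`);
* `twoSixPayoff`: the general pencil theorem `PencilBound` at `k = 6`, `a = (0,1,1,1,1,1)`,
  `b = (1,−1,−3,3,−5,−9)` (`Fin.prod_univ_six` identifies `∏ Lᵢ` with `F`; the six forms are pairwise
  non-proportional) gives `log H ≤ C₀ · rad(F)^{1/6+ε}`; with the dictionary
  (`|Δ_min| ≤ |64 …|`, `rad F ∣ 6N`): `log|Δ_min| ≤ log A + 24 log H ≤ C · N^{1/6+ε}`,
  `C = log A + 24 · max(C₀, 0) · 6^{1/6+ε}`, `A = 4892236185600`.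

HONESTY. Glue; the class theorem it yields (`TwoSixClassEpsShape`, Szpiro exponent `1/6` for every
`E/ℚ` with torsion ⊇ ℤ/2×ℤ/6) is an ε-column / Szpiro-by-class RECORD — NOT abc, NOT A-PS
(polynomial Szpiro), NOT rung A1′; the route reaches `ABC` only through its DECLARED RESIDUAL
`TwoSixResidual`. [folklore] bookkeeping; inputs: [StewartYu2001] Thm 2, [SilvermanAEC2009] VII.
-/

set_option linter.dupNamespace false

namespace Summit.ABC.ABC.Theorems

open UniqueFactorizationMonoid WeierstrassCurve
open Summit.ABC.ABC.Theses.TwoSixPencil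

namespace TwoSixPayoff

/-- Height bound for the ℤ/2×ℤ/6 discriminant form:
`|64 w⁶(u−w)⁶(u−3w)²(u+3w)²(u−5w)⁶(u−9w)²| ≤ 4892236185600 · max(|u|,|w|)²⁴`. [folklore] -/
theorem abs_disc_le (u w : ℤ) :
    |(((64 * (w ^ 6 * (u - w) ^ 6 * (u - 3 * w) ^ 2 * (u + 3 * w) ^ 2 * (u - 5 * w) ^ 6 *
        (u - 9 * w) ^ 2) : ℤ)) : ℝ)| ≤ 4892236185600 * (((max |u| |w| : ℤ)) : ℝ) ^ 24 := by
  set H : ℝ := ((max |u| |w| : ℤ) : ℝ) with hH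
  have hHeq : H = max |(u : ℝ)| |(w : ℝ)| := by rw [hH]; push_cast; rfl
  have hu : |(u : ℝ)| ≤ H := hHeq ▸ le_max_left _ _
  have hw : |(w : ℝ)| ≤ H := hHeq ▸ le_max_right _ _
  have hH0 : 0 ≤ H := (abs_nonneg _).trans hu
  have hlin : ∀ c : ℝ, |(u : ℝ) - c * w| ≤ (1 + |c|) * H := by
    intro c
    calc |(u : ℝ) - c * w| ≤ |(u : ℝ)| + |c * (w : ℝ)| := abs_sub _ _
      _ = |(u : ℝ)| + |c| * |(w : ℝ)| := by rw [abs_mul]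
      _ ≤ H + |c| * H := add_le_add hu (mul_le_mul_of_nonneg_left hw (abs_nonneg c))
      _ = (1 + |c|) * H := by ring
  have h1 : |(u : ℝ) - w| ≤ 2 * H := by
    have := hlin 1; rw [one_mul, abs_one] at this; linarith
  have h3 : |(u : ℝ) - 3 * w| ≤ 4 * H := by
    have := hlin 3; rw [show |(3 : ℝ)| = 3 by norm_num] at this; linarith
  have hm3 : |(u : ℝ) + 3 * w| ≤ 4 * H := by
    have := hlin (-3); rw [show |(-3 : ℝ)| = 3 by norm_num, neg_mul, sub_neg_eq_add] at this; linarith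
  have h5 : |(u : ℝ) - 5 * w| ≤ 6 * H := by
    have := hlin 5; rw [show |(5 : ℝ)| = 5 by norm_num] at this; linarith
  have h9 : |(u : ℝ) - 9 * w| ≤ 10 * H := by
    have := hlin 9; rw [show |(9 : ℝ)| = 9 by norm_num] at this; linarith
  push_cast
  rw [abs_mul, abs_mul, abs_mul, abs_mul, abs_mul, abs_mul, abs_pow, abs_pow, abs_pow, abs_pow,
    abs_pow, abs_pow, show |(64 : ℝ)| = 64 by norm_num]
  calc 64 * (|(w : ℝ)| ^ 6 * |(u : ℝ) - w| ^ 6 * |(u : ℝ) - 3 * w| ^ 2 * |(u : ℝ) + 3 * w| ^ 2 *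
        |(u : ℝ) - 5 * w| ^ 6 * |(u : ℝ) - 9 * w| ^ 2)
      ≤ 64 * (H ^ 6 * (2 * H) ^ 6 * (4 * H) ^ 2 * (4 * H) ^ 2 * (6 * H) ^ 6 * (10 * H) ^ 2) := by
        gcongr
    _ = 4892236185600 * H ^ 24 := by ring

/-- The six cusp forms `w, u−w, u−3w, u+3w, u−5w, u−9w` — coefficient vectors `a = (0,1,1,1,1,1)`,
`b = (1,−1,−3,3,−5,−9)` — are pairwise non-proportional. [folklore] -/
theorem pairwise_six : ∀ i j : Fin 6, i ≠ j →
    (![0, 1, 1, 1, 1, 1] i : ℤ) * (![1, -1, -3, 3, -5, -9] j) ≠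
      (![0, 1, 1, 1, 1, 1] j) * (![1, -1, -3, 3, -5, -9] i) := by
  intro i j hij
  fin_cases i <;> fin_cases j <;> first | exact absurd rfl hij | norm_num

/-- `∏ᵢ (aᵢu + bᵢw) = F(u,w) = w(u−w)(u−3w)(u+3w)(u−5w)(u−9w)` for the six cusp forms. [folklore] -/
theorem prod_six (u w : ℤ) :
    ∏ i : Fin 6, ((![0, 1, 1, 1, 1, 1] i : ℤ) * u + (![1, -1, -3, 3, -5, -9] i) * w) =
      w * (u - w) * (u - 3 * w) * (u + 3 * w) * (u - 5 * w) * (u - 9 * w) := by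
  rw [Fin.prod_univ_six]
  simp only [Matrix.cons_val_zero, Matrix.cons_val_one, Matrix.cons_val]
  ring

/-- **The payoff** (unfolded): the general pencil theorem `PencilBound` (at `k = 6`) and the
dictionary `TwoSixDictionary` give the class theorem `TwoSixClassEpsShape`, with
`C = log A + 24 · max(C₀, 0) · 6^{1/6+ε}`, `A = 4892236185600`. [folklore] -/
theorem twoSixPayoff (hP : PencilBound) (hD : TwoSixDictionary) : TwoSixClassEpsShape := by
  unfold TwoSixClassEpsShape
  unfold PencilBound at hP
  unfold TwoSixDictionary at hD
  intro ε hε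
  obtain ⟨C₀, hC₀⟩ :=
    hP 6 ![0, 1, 1, 1, 1, 1] ![1, -1, -3, 3, -5, -9] (by norm_num) pairwise_six ε hε
  set e : ℝ := 1 / 6 + ε with he
  have he0 : 0 < e := by positivity
  have he' : (1 / ((6 : ℕ) : ℝ) + ε) = e := by rw [he]; norm_num
  refine ⟨Real.log 4892236185600 + 24 * max C₀ 0 * (6 : ℝ) ^ e, ?_⟩
  intro u w huw h0 W _ hW
  obtain ⟨hΔ, hrad⟩ := hD u w huw h0 W hW
  have hlogH := hC₀ u w huw (by rw [prod_six]; exact h0)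
  rw [prod_six, he'] at hlogH
  -- positivity of the invariants
  have hΔpos : 0 < (W.minimalDiscriminantNorm ℤ : ℝ) := by
    exact_mod_cast minimalDiscriminantNorm_pos_holds W
  have hNposℕ : 0 < W.conductorNorm ℤ := conductorNorm_pos_holds W
  have hNpos : 0 < (W.conductorNorm ℤ : ℝ) := by exact_mod_cast hNposℕ
  have hN1 : 1 ≤ (W.conductorNorm ℤ : ℝ) := by exact_mod_cast hNposℕ
  -- the height `H = max(|u|, |w|) ≥ 1`
  have hH1 : (1 : ℝ) ≤ ((max |u| |w| : ℤ) : ℝ) := by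
    have h1 : (1 : ℤ) ≤ max |u| |w| := by
      rcases huw.ne_zero_or_ne_zero with hu | hw
      · exact le_max_of_le_left (Int.one_le_abs hu)
      · exact le_max_of_le_right (Int.one_le_abs hw)
    exact_mod_cast h1
  have hH0 : (0 : ℝ) < ((max |u| |w| : ℤ) : ℝ) := by linarith
  -- `rad ≤ 6 N`
  have hR : (((radical (w * (u - w) * (u - 3 * w) * (u + 3 * w) * (u - 5 * w) * (u - 9 * w))).natAbs
      : ℕ) : ℝ) ≤ 6 * (W.conductorNorm ℤ : ℝ) := by
    have h1 := Nat.le_of_dvd (by positivity) hrad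
    exact_mod_cast h1
  have hR0 : (0 : ℝ) ≤ (((radical (w * (u - w) * (u - 3 * w) * (u + 3 * w) * (u - 5 * w) *
      (u - 9 * w))).natAbs : ℕ) : ℝ) := Nat.cast_nonneg _
  -- `log H ≤ C₀⁺ · 6^e · N^e`
  have hHe : Real.log ((max |u| |w| : ℤ) : ℝ) ≤
      max C₀ 0 * ((6 : ℝ) ^ e * (W.conductorNorm ℤ : ℝ) ^ e) := by
    calc Real.log ((max |u| |w| : ℤ) : ℝ)
        ≤ C₀ * (((radical (w * (u - w) * (u - 3 * w) * (u + 3 * w) * (u - 5 * w) *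
            (u - 9 * w))).natAbs : ℕ) : ℝ) ^ e := hlogH
      _ ≤ max C₀ 0 * (((radical (w * (u - w) * (u - 3 * w) * (u + 3 * w) * (u - 5 * w) *
            (u - 9 * w))).natAbs : ℕ) : ℝ) ^ e :=
          mul_le_mul_of_nonneg_right (le_max_left _ _) (Real.rpow_nonneg hR0 _)
      _ ≤ max C₀ 0 * (6 * (W.conductorNorm ℤ : ℝ)) ^ e :=
          mul_le_mul_of_nonneg_left (Real.rpow_le_rpow hR0 hR he0.le) (le_max_right _ _)
      _ = max C₀ 0 * ((6 : ℝ) ^ e * (W.conductorNorm ℤ : ℝ) ^ e) := by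
          rw [Real.mul_rpow (by norm_num) hNpos.le]
  -- `log Δ_min ≤ log A + 24 log H`
  have hdisc_pos : 0 < |(((64 * (w ^ 6 * (u - w) ^ 6 * (u - 3 * w) ^ 2 * (u + 3 * w) ^ 2 *
      (u - 5 * w) ^ 6 * (u - 9 * w) ^ 2) : ℤ)) : ℝ)| :=
    lt_of_lt_of_le hΔpos hΔ
  have hlogΔ : Real.log (W.minimalDiscriminantNorm ℤ : ℝ) ≤
      Real.log 4892236185600 + 24 * Real.log ((max |u| |w| : ℤ) : ℝ) := by
    calc Real.log (W.minimalDiscriminantNorm ℤ : ℝ)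
        ≤ Real.log |(((64 * (w ^ 6 * (u - w) ^ 6 * (u - 3 * w) ^ 2 * (u + 3 * w) ^ 2 *
            (u - 5 * w) ^ 6 * (u - 9 * w) ^ 2) : ℤ)) : ℝ)| := Real.log_le_log hΔpos hΔ
      _ ≤ Real.log (4892236185600 * ((max |u| |w| : ℤ) : ℝ) ^ 24) :=
          Real.log_le_log hdisc_pos (abs_disc_le u w)
      _ = Real.log 4892236185600 + 24 * Real.log ((max |u| |w| : ℤ) : ℝ) := by
          rw [Real.log_mul (by norm_num) (by positivity), Real.log_pow]; push_cast; ring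
  -- assemble
  have hNe1 : 1 ≤ (W.conductorNorm ℤ : ℝ) ^ e := Real.one_le_rpow hN1 he0.le
  have hlogA : 0 ≤ Real.log 4892236185600 := Real.log_nonneg (by norm_num)
  calc Real.log (W.minimalDiscriminantNorm ℤ : ℝ)
      ≤ Real.log 4892236185600 + 24 * Real.log ((max |u| |w| : ℤ) : ℝ) := hlogΔ
    _ ≤ Real.log 4892236185600 * (W.conductorNorm ℤ : ℝ) ^ e +
          24 * (max C₀ 0 * ((6 : ℝ) ^ e * (W.conductorNorm ℤ : ℝ) ^ e)) :=
        add_le_add (le_mul_of_one_le_right hlogA hNe1) (by linarith [hHe])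
    _ = (Real.log 4892236185600 + 24 * max C₀ 0 * (6 : ℝ) ^ e) * (W.conductorNorm ℤ : ℝ) ^ e := by
        ring

end TwoSixPayoff

/-- **Closes stmt-ABC-24785 `TwoSixPayoff` of route `TwoSixPencil`**:
`PencilBound → TwoSixDictionary → TwoSixClassEpsShape` (the general pencil theorem at `k = 6` with
the six cusp forms of `X₁(2,6)`, `|Δ| ≤ A·H²⁴`, `rad ∣ 6N`). Glue only; NOT abc, NOT A-PS, moves no
rung. [folklore] -/
theorem twoSixPayoff_proof : Summit.ABC.ABC.Theses.TwoSixPencil.TwoSixPayoff := by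
  unfold Summit.ABC.ABC.Theses.TwoSixPencil.TwoSixPayoff
  exact TwoSixPayoff.twoSixPayoff

end Summit.ABC.ABC.Theorems
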